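import Mathlib
import Summits.NavierStokesRegularity.NavierStokesRegularity.Theorems.FilamentSkeletonRssAnalyticStripLiaSymbolDefs
import Summits.NavierStokesRegularity.NavierStokesRegularity.Theorems.FilamentSkeletonRssTangentSkeletonNearStraightLiaSymbol
import Summits.NavierStokesRegularity.NavierStokesRegularity.Theorems.FilamentSkeletonRssClause13TaylorRemainderKernel
import Summits.NavierStokesRegularity.NavierStokesRegularity.Theorems.FilamentSkeletonRssClause13SymbolLink

/-!
# Clause 13-J, brick B3′: EXPONENTIAL SATURATION of the self-induction symbol, `0 ≤ 1 − 𝔖(x) ≤ 5·e^{−x/2}`, and the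
# Fourier transform of the B2 smoothing kernel, `∫ (2q − s²)(s²+q)^{-5/2} cos(ks) ds = (2/q)(1 − 𝔖(k√q))`

Route `FilamentSkeletonRss`, child 28296 `Clause13NearStraight` of `SkeletonJ1G` (stmt-27849); design of record = tenure note
`filament-plan/DESIGN-NOTE-28296-tenure-g22.md` §2 (far transport branch (β): "𝔖 → 1 exponentially, so on (β) the self term IS the
point rotation `iG·J` up to `O(G e^{−μ|k|})`") and the lane memos `DESIGN-28296-clause13-g12.md` / `DESIGN-28296-transport-g13.md` §1, §5 B3′.
Typing-agnostic (constant core `q = μ²`; valid verbatim under the A1L retype).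

* `Cint_le_exp`, `Eint_le_exp` : `C(p) ≤ 2e^{−√p}`, `E(p) ≤ 4e^{−√p}/(e·p)` for the tree's `C(p) = ∫₀^∞ e^{−t−p/t} dt`,
  `E(p) = ∫₀^∞ e^{−t−p/t} dt/t` (`…LiaSymbolNumericsDefs`), from `t + p/t ≥ √p + t/2 + p/(2t)` and `y e^{−y} ≤ e^{−1}`;
* `one_sub_liaSym_nonneg`, `one_sub_liaSym_le_exp` : `0 ≤ 1 − 𝔖(x)` and `1 − 𝔖(x) ≤ 5 e^{−x/2}` (`x > 0`), via `𝔖(x) = Φ(x²/4) =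
  1 − C − 2pE` (`liaSym_eq_Phi`, p656939's §1) — numerically `1 − 𝔖 = 0.43 @ 3, 0.011 @ 8, 3.4e-4 @ 12`;
* `integral_smoothingKernel_cos` / `_sin` / `integral_smoothingKernel` : the B2 kernel `K(s) = (2q − s²)(s²+q)^{-5/2}` of
  `taylorRemainderOp_eq` (`M_q[f] = (2/q)f − K∗f`) has `K∗cos k· = (2/q)(1 − 𝔖(k√q)) cos k·`, `∫K = 2/q` — B2 combined with B3
  (`taylorRemainderOp_cos/sin`, p661551).  So `k_q := (q/2)K` is a probability kernel with `k̂_q(ξ) = 1 − 𝔖(ξ√q) ∈ [0, 1]`, `≤ 5e^{−|ξ|√q/2}`.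

Lane ns-filament-19175-p1 g13; `--supports stmt-NavierStokesRegularity-28296 --as helper`.
HONEST FRAMING: facts about explicit real integrals attached to a HYPOTHETICAL filament skeleton on the NEGATIVE side of a MODEL route;
nothing here bears on Navier–Stokes regularity or blow-up.
-/

set_option linter.dupNamespace false

noncomputable section

open Real Set MeasureTheory

namespace Summit.NavierStokesRegularity.NavierStokesRegularity.Theorems.AnalyticStripLiaSymbol

/-! ### Exponential bounds for `C(p)` and `E(p)` -/

/-- AM–GM in the form used twice: `√p ≤ t/2 + p/(2t)` for `t > 0`, `p ≥ 0`. [folklore] -/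
theorem sqrt_le_half_add {p t : ℝ} (hp : 0 ≤ p) (ht : 0 < t) : √p ≤ t / 2 + p / (2 * t) := by
  have hsq : (√p) ^ 2 = p := Real.sq_sqrt hp
  rw [div_add_div _ _ (by norm_num : (2:ℝ) ≠ 0) (by positivity : 2 * t ≠ 0), le_div_iff₀ (by positivity)]
  nlinarith [sq_nonneg (t - √p), Real.sqrt_nonneg p]

/-- The key pointwise bound: `e^{−t} e^{−p/t} ≤ e^{−√p} · e^{−t/2} · e^{−p/(2t)}` for `t > 0`. [folklore] -/
theorem exp_neg_mul_exp_neg_div_le {p t : ℝ} (hp : 0 ≤ p) (ht : 0 < t) :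
    Real.exp (-t) * Real.exp (-(p / t)) ≤ Real.exp (-√p) * Real.exp (-(1 / 2) * t) * Real.exp (-(p / 2 / t)) := by
  rw [← Real.exp_add, ← Real.exp_add, ← Real.exp_add, Real.exp_le_exp]
  have h := sqrt_le_half_add hp ht
  have e1 : p / 2 / t = p / (2 * t) := by rw [div_div]
  have e2 : p / t = 2 * (p / (2 * t)) := by field_simp
  rw [e1, e2]
  linarith

/-- `∫₀^∞ e^{−t/2} dt = 2` and integrability. [folklore] -/
theorem integral_exp_neg_half_Ioi : ∫ t in Ioi (0:ℝ), Real.exp (-(1 / 2) * t) = 2 := by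
  have h := integral_exp_mul_Ioi (a := -(1 / 2)) (by norm_num) 0
  rw [h]; norm_num

/-- `C(p) ≤ 2·e^{−√p}` for `p ≥ 0`. [folklore] -/
theorem Cint_le_exp {p : ℝ} (hp : 0 ≤ p) : Numerics.Cint p ≤ 2 * Real.exp (-√p) := by
  unfold Numerics.Cint
  have hI : IntegrableOn (fun t : ℝ => Real.exp (-(1 / 2) * t)) (Ioi 0) := exp_neg_integrableOn_Ioi 0 (by norm_num)
  have hpt : ∀ t ∈ Ioi (0:ℝ), Real.exp (-t) * Real.exp (-(p / t)) ≤ Real.exp (-√p) * Real.exp (-(1 / 2) * t) := by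
    intro t ht
    have ht : (0:ℝ) < t := ht
    have h1 := exp_neg_mul_exp_neg_div_le hp ht
    have h2 : Real.exp (-(p / 2 / t)) ≤ 1 := by
      rw [Real.exp_le_one_iff]; exact neg_nonpos.mpr (by positivity)
    calc Real.exp (-t) * Real.exp (-(p / t))
        ≤ Real.exp (-√p) * Real.exp (-(1 / 2) * t) * Real.exp (-(p / 2 / t)) := h1
      _ ≤ Real.exp (-√p) * Real.exp (-(1 / 2) * t) * 1 := by gcongr
      _ = Real.exp (-√p) * Real.exp (-(1 / 2) * t) := mul_one _
  calc ∫ t in Ioi (0:ℝ), Real.exp (-t) * Real.exp (-(p / t))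
      ≤ ∫ t in Ioi (0:ℝ), Real.exp (-√p) * Real.exp (-(1 / 2) * t) :=
        setIntegral_mono_on (Numerics.integrableOn_fC hp) (hI.const_mul _) measurableSet_Ioi hpt
    _ = 2 * Real.exp (-√p) := by rw [integral_const_mul, integral_exp_neg_half_Ioi, mul_comm]

/-- `e^{−(p/2)/t}/t ≤ 2/(e·p)` for `t, p > 0` (`y e^{−y} ≤ e^{−1}` at `y = p/(2t)`). [folklore] -/
theorem exp_neg_half_div_div_le {p t : ℝ} (hp : 0 < p) (ht : 0 < t) :
    Real.exp (-(p / 2 / t)) / t ≤ 2 / (Real.exp 1 * p) := by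
  set r := p / 2 with hr
  have hr0 : 0 < r := by positivity
  have hy : r / t ≤ Real.exp (r / t - 1) := by linarith [Real.add_one_le_exp (r / t - 1)]
  have hkey : Real.exp (-(r / t)) / t ≤ 1 / (Real.exp 1 * r) := by
    rw [Real.exp_sub, div_le_div_iff₀ ht (Real.exp_pos 1)] at hy
    rw [Real.exp_neg, div_le_div_iff₀ ht (by positivity)]
    calc (Real.exp (r / t))⁻¹ * (Real.exp 1 * r) = (r * Real.exp 1) / Real.exp (r / t) := by ring
      _ ≤ (Real.exp (r / t) * t) / Real.exp (r / t) := by gcongr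
      _ = 1 * t := by field_simp
  calc Real.exp (-(r / t)) / t ≤ 1 / (Real.exp 1 * r) := hkey
    _ = 2 / (Real.exp 1 * p) := by rw [hr]; field_simp

/-- `E(p) ≤ 4·e^{−√p}/(e·p)` for `p > 0`. [folklore] -/
theorem Eint_le_exp {p : ℝ} (hp : 0 < p) : Numerics.Eint p ≤ 4 / (Real.exp 1 * p) * Real.exp (-√p) := by
  unfold Numerics.Eint
  have hI : IntegrableOn (fun t : ℝ => Real.exp (-(1 / 2) * t)) (Ioi 0) := exp_neg_integrableOn_Ioi 0 (by norm_num)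
  have hpt : ∀ t ∈ Ioi (0:ℝ), Real.exp (-t) * Real.exp (-(p / t)) / t
      ≤ (2 / (Real.exp 1 * p) * Real.exp (-√p)) * Real.exp (-(1 / 2) * t) := by
    intro t ht
    have ht : (0:ℝ) < t := ht
    have h1 := exp_neg_mul_exp_neg_div_le hp.le ht
    have h2 := exp_neg_half_div_div_le hp ht
    calc Real.exp (-t) * Real.exp (-(p / t)) / t
        ≤ (Real.exp (-√p) * Real.exp (-(1 / 2) * t) * Real.exp (-(p / 2 / t))) / t :=
          div_le_div_of_nonneg_right h1 ht.le
      _ = Real.exp (-√p) * Real.exp (-(1 / 2) * t) * (Real.exp (-(p / 2 / t)) / t) := by ring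
      _ ≤ Real.exp (-√p) * Real.exp (-(1 / 2) * t) * (2 / (Real.exp 1 * p)) := by gcongr
      _ = (2 / (Real.exp 1 * p) * Real.exp (-√p)) * Real.exp (-(1 / 2) * t) := by ring
  calc ∫ t in Ioi (0:ℝ), Real.exp (-t) * Real.exp (-(p / t)) / t
      ≤ ∫ t in Ioi (0:ℝ), (2 / (Real.exp 1 * p) * Real.exp (-√p)) * Real.exp (-(1 / 2) * t) :=
        setIntegral_mono_on (integrableOn_E_integrand hp) (hI.const_mul _) measurableSet_Ioi hpt
    _ = 4 / (Real.exp 1 * p) * Real.exp (-√p) := by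
        rw [integral_const_mul, integral_exp_neg_half_Ioi]; ring

/-! ### Saturation of the symbol: `0 ≤ 1 − 𝔖 ≤ 5 e^{−x/2}` -/

/-- `𝔖(x) ≤ 1` for all `x` (`𝔖 = 1 − C − 2pE` with `C, E ≥ 0`; `𝔖(0) = 0`). [folklore] -/
theorem one_sub_liaSym_nonneg (x : ℝ) : 0 ≤ 1 - liaSym x := by
  rcases eq_or_ne x 0 with hx | hx
  · rw [hx, liaSym_zero]; norm_num
  · rw [liaSym_eq_Phi x hx, Numerics.Phi]
    have hp : 0 < x ^ 2 / 4 := by positivity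
    have hC : 0 ≤ Numerics.Cint (x ^ 2 / 4) :=
      setIntegral_nonneg measurableSet_Ioi fun t _ => Numerics.fC_nonneg _ t
    have hE : 0 ≤ Numerics.Eint (x ^ 2 / 4) := Numerics.Eint_nonneg _
    nlinarith

/-- **B3′ — exponential saturation.** `1 − 𝔖(x) ≤ 5·e^{−x/2}` for `x > 0`: with `p = x²/4`, `√p = x/2`,
`1 − 𝔖 = C + 2pE ≤ (2 + 8/e)e^{−x/2}` and `8/e < 3`. [folklore] -/
theorem one_sub_liaSym_le_exp (x : ℝ) (hx : 0 < x) : 1 - liaSym x ≤ 5 * Real.exp (-(x / 2)) := by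
  have hp : 0 < x ^ 2 / 4 := by positivity
  have hsq : √(x ^ 2 / 4) = x / 2 := by
    rw [show x ^ 2 / 4 = (x / 2) ^ 2 by ring, Real.sqrt_sq (by positivity)]
  rw [liaSym_eq_Phi x hx.ne', Numerics.Phi]
  have hC := Cint_le_exp hp.le
  have hE := Eint_le_exp hp
  rw [hsq] at hC hE
  have he : Real.exp 1 > 2.7 := lt_trans (by norm_num) Real.exp_one_gt_d9
  have hex : 0 < Real.exp (-(x / 2)) := Real.exp_pos _
  have h2pE : 2 * (x ^ 2 / 4) * Numerics.Eint (x ^ 2 / 4) ≤ (8 / Real.exp 1) * Real.exp (-(x / 2)) := by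
    have := mul_le_mul_of_nonneg_left hE (by positivity : (0:ℝ) ≤ 2 * (x ^ 2 / 4))
    refine this.trans (le_of_eq ?_)
    field_simp
    norm_num
  have h8e : 8 / Real.exp 1 ≤ 3 := by
    rw [div_le_iff₀ (Real.exp_pos 1)]; linarith
  nlinarith [mul_le_mul_of_nonneg_right h8e hex.le]

end Summit.NavierStokesRegularity.NavierStokesRegularity.Theorems.AnalyticStripLiaSymbol

namespace Summit.NavierStokesRegularity.NavierStokesRegularity.Theorems.MatchedKernel

open Summit.NavierStokesRegularity.NavierStokesRegularity.Theorems.AnalyticStripLiaSymbol (liaSym liaSym_zero)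

/-! ### The Fourier transform of the B2 smoothing kernel `K(s) = (2q − s²)(s²+q)^{-5/2}` -/

/-- **B2 ∘ B3.** `∫ (2q − (τ−σ)²)((τ−σ)²+q)^{-5/2} cos(kσ) dσ = (2/q)(1 − 𝔖(k√q))·cos(kτ)`: the smoothing kernel of
`taylorRemainderOp_eq` acts on plane waves as the multiplier `(2/q)(1 − liaSym(k√q))`. [folklore] -/
theorem integral_smoothingKernel_cos {q : ℝ} (hq : 0 < q) (k τ : ℝ) :
    ∫ σ : ℝ, (2 * q - (τ - σ) ^ 2) * (((τ - σ) ^ 2 + q) ^ (5 / 2 : ℝ))⁻¹ * Real.cos (k * σ)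
      = 2 / q * (1 - liaSym (k * √q)) * Real.cos (k * τ) := by
  have hB2 := taylorRemainderOp_eq hq (f := fun x : ℝ => Real.cos (k * x)) (B := max 1 |k|) (by fun_prop)
    (fun x => (Real.abs_cos_le_one _).trans (le_max_left _ _))
    (fun x => by
      rw [deriv_cos_mul, abs_mul, abs_neg]
      exact (mul_le_of_le_one_right (abs_nonneg k) (Real.abs_sin_le_one _)).trans (le_max_right _ _)) τ
  have hB3 := taylorRemainderOp_cos hq k τ
  rw [hB3] at hB2
  linarith

/-- The sine companion: `∫ (2q − (τ−σ)²)((τ−σ)²+q)^{-5/2} sin(kσ) dσ = (2/q)(1 − 𝔖(k√q))·sin(kτ)`. [folklore] -/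
theorem integral_smoothingKernel_sin {q : ℝ} (hq : 0 < q) (k τ : ℝ) :
    ∫ σ : ℝ, (2 * q - (τ - σ) ^ 2) * (((τ - σ) ^ 2 + q) ^ (5 / 2 : ℝ))⁻¹ * Real.sin (k * σ)
      = 2 / q * (1 - liaSym (k * √q)) * Real.sin (k * τ) := by
  have hB2 := taylorRemainderOp_eq hq (f := fun x : ℝ => Real.sin (k * x)) (B := max 1 |k|) (by fun_prop)
    (fun x => (Real.abs_sin_le_one _).trans (le_max_left _ _))
    (fun x => by
      rw [deriv_sin_mul, abs_mul]
      exact (mul_le_of_le_one_right (abs_nonneg k) (Real.abs_cos_le_one _)).trans (le_max_right _ _)) τ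
  have hB3 := taylorRemainderOp_sin hq k τ
  rw [hB3] at hB2
  linarith

/-- Normalisation: `∫ (2q − (τ−σ)²)((τ−σ)²+q)^{-5/2} dσ = 2/q` (the `k = 0` wave; `𝔖(0) = 0`), i.e. `k_q = (q/2)K` has mass one. [folklore] -/
theorem integral_smoothingKernel {q : ℝ} (hq : 0 < q) (τ : ℝ) :
    ∫ σ : ℝ, (2 * q - (τ - σ) ^ 2) * (((τ - σ) ^ 2 + q) ^ (5 / 2 : ℝ))⁻¹ = 2 / q := by
  have h := integral_smoothingKernel_cos hq 0 τ
  simpa only [zero_mul, Real.cos_zero, mul_one, liaSym_zero, sub_zero] using h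

end Summit.NavierStokesRegularity.NavierStokesRegularity.Theorems.MatchedKernel
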